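import Literature.NumberTheory.Automorphic.HyperspecialUnitarySatakeCountingImage
import Literature.NumberTheory.Automorphic.IntegralSatakeIsomorphismGL
import Literature.NumberTheory.Automorphic.HyperspecialUnitaryHeckeAlgebraStructure
import Mathlib.FieldTheory.Finite.Basic
import HarnessLib

/-!
# Herzig's / Henniart–Vignéras' Satake isomorphism in characteristic `p` for the hyperspecial unitary group `U(σ, J₀)`
# (trivial weight): over every commutative ring `R` with `q_F = 0` in `R`, the counting transform `𝒮_1` maps
# `ℋ(U_N, K₀; R)` isomorphically onto the functions supported on the ANTIDOMINANT cocharacters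
# (Herzig 2011 Thm. 1.2, Cor. 1.3; Henniart–Vignéras 2015 Thm. 1.5, §7.15)

Topic `NumberTheory/Automorphic`; namespace `Literature.NumberTheory.Automorphic.HermitianLattice[.UnramifiedLocalConjDatum]`
(lane `lit-hodgefound`, Track 2 foundations; seat `lit-hodgefound-p11`, generation 49, row g49-#7).  THEOREMS ONLY: no
definition, no named fact, no instance, no notation.  The `U_N`-analogue of the tree's `GL_n` file `SatakeIsomorphismCharPGL`
(g42-#12), obtained by specialising the integral image theorem of g49-#6 (`HyperspecialUnitarySatakeCountingImage`:
`𝒮_1(ℋ_R) = 𝒯_R(q_F)`, every `R`) to `q_F = 0`.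

## The mathematics and the print

`G = U_N = U(σ, J₀^{(N)})` over the fixed field `K₀` of `σ ≠ id` (finite residue field, `q = q_F²`), `K₀ = U_N ∩ GL_N(𝒪_K)`
hyperspecial, `a(γ) ∈ ℤ^N` the Iwasawa exponents, `W = C_{S_N}(rev)`, `⟨ν, μ⟩ = satakeTwistExp μ`; the antidominant cone
`Λ^{--} = {c ∈ ℤ^N : c monotone, c_{rev i} = -c_i}` (the tree's indexing of the Cartan representatives `t_c = ϖ^c`,
`coeff_satakeTransform_doubleCosetOperator_zpowDiagGL_monotone_unitary`).  The counting transform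
`𝒮_1(T) = ∑_μ #{γ ∈ T : a(γ) = μ} x^μ` is Herzig's `𝒮 f (t) = ∑_{u ∈ U(F)/U(𝒪)} f(tu)` for the trivial weight `V = 1`
([Herzig2010] §1.2: «Leaving [`δ^{1/2}`] out still yields an algebra homomorphism `𝒮'` into `ℂ[X_*(S)]`, which now also makes
sense over `ℤ`»), and Henniart–Vignéras' `S_C`.

[Herzig2010] Thm. 1.2 (`F/ℚ_p` finite, `G` unramified, `K` hyperspecial, `V` irreducible over `𝔽̄_p`): «`𝒮 : ℋ_G(V) → ℋ_T(V^{U(k)})`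
[…] is an injective `k̄`-algebra homomorphism with image `ℋ⁻_T(V^{U(k)})`» (the functions supported on the antidominant
monoid `T⁻`); Cor. 1.3: «`ℋ_G(V)` is commutative and isomorphic to `k̄[X_*(S)_-]`.  In particular it is noetherian»; §1.2:
«when `V` is trivial there is a simple explanation why the image of `𝒮` is supported on antidominant coweights.  The image of the
Satake transform is `W`-invariant and the modulus character is a power of `p` which, among the `W`-conjugates of a given coweight,
is biggest on the antidominant one».  [HenniartVigneras2013] Thm. 1.5 (any local `F`, `C` a field of characteristic `p`, `V = C`):
«(i) `S` injective. (ii) Its image is the space of functions supported on antidominant elements of `Z`»; §7.15 Thm. (any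
commutative `C`): «`S_C : H(G, K, C) → C[Λ]` is injective and the family `1_C ⊗ S_λ`, `λ` in `Λ⁻`, is a basis of its image»,
Remark 1: «Assume `p · 1_C = 0`. […] `1_C ⊗ S_λ = 1_C ⊗ e_λ` for all `λ` in `Λ⁻`».

HERE: for the hyperspecial unitary group over ANY non-archimedean local field `K₀` (any characteristic) and ANY commutative ring
`R` in which `q_F = 0` — e.g. every ring of characteristic `p = char 𝓀` (`natCast_sqrt_card_residueField_eq_zero_of_charP`) —
the image of `𝒮_1 : ℋ(U_N, K₀; R) → R[ℤ^N]` (injective over every `R`, g43) is EXACTLY the `R`-module of `f` with every exponent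
in `Λ^{--}`.  PROOF (Herzig's «simple explanation», made unconditional by g49-#6): `𝒮_1(ℋ_R) = 𝒯_R(q_F)` is cut out by
`supp f ⊆ {antisymmetric}` and `f_{μ∘π} = q_F^{⟨ν,μ∘π⟩-⟨ν,μ⟩} f_μ` (`π ∈ W`, `⟨ν,μ⟩ ≤ ⟨ν,μ∘π⟩`); every antisymmetric `μ` has a
`W`-conjugate `m = μ∘π₀ ∈ Λ^{--}` (`exists_perm_rev_monotone_comp`, from the head-sum-lex-minimum lemma of g49-#6), and
`⟨ν, ·⟩` is minimised on the `S_N`-orbit of a monotone `m` exactly at `m` (Zhu's rearrangement lemma, g43-#1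
`satakeTwistExp_le_satakeTwistExp_comp_perm` / `satakeTwistExp_comp_perm_eq_iff`); so with `q_F = 0` the relation at
`(m, π₀⁻¹)` reads `f_μ = 0^{⟨ν,μ⟩-⟨ν,m⟩} f_m`, i.e. `f_μ = 0` unless `μ = m`; conversely a function supported on `Λ^{--}`
satisfies all the relations (both sides vanish unless `μ = μ∘π ∈ Λ^{--}`).

## What is formalised (theorems only)

* §1 `exists_perm_rev_monotone_comp` (antidominant representatives of `W`-orbits of antisymmetric cocharacters),
  `comp_perm_eq_self_of_monotone_of_satakeTwistExp_le`.
* §2 **`mem_twistedSatakeTarget_iff_of_cast_eq_zero`** (`(b : R) = 0 ⇒ (f ∈ 𝒯_R(b) ⟺ supp f ⊆ Λ^{--})`).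
* §3 `natCast_sqrt_card_residueField_eq_zero_of_charP` (`char R = char 𝓀 ⇒ q_F = 0` in `R`),
  **`monotone_of_coeff_satakeTransform_one_ne_zero_unitary`** (THM. 1.2, support),
  **`mem_range_satakeTransform_one_iff_of_cast_eq_zero_unitary`** (THM. 1.2: `f ∈ 𝒮_1(ℋ_R) ⟺ supp f ⊆ Λ^{--}`),
  `single_mem_range_satakeTransform_one_unitary` (every `x^c`, `c ∈ Λ^{--}`, is a transform — HV §7.15 Remark 1),
  `mem_range_satakeTransform_one_iff_of_charP_unitary`, `exists_algEquiv_range_satakeTransform_one_unitary` (COR. 1.3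
  `ℋ_R ≃ₐ[R] 𝒮_1(ℋ_R) = R[Λ^{--}]`), `isNoetherianRing_heckeAlgebra_unitaryInt` (COR. 1.3 «noetherian», every noetherian `R`, from
  g43-#5 `ℋ_R ≅ R[X_1, …, X_{⌊N/2⌋}]`).

## References
* [Herzig2010] F. Herzig, *A Satake isomorphism in characteristic p*, Compositio Math. 147 (2011) 263–283, Thm. 1.2, Cor. 1.3, §1.2.
* [HenniartVigneras2013] G. Henniart, M.-F. Vignéras, *A Satake isomorphism for representations modulo p of reductive groups over
  local fields*, J. reine angew. Math. 701 (2015) 33–75, Thm. 1.5, §7.13–§7.15.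
* [ZhuIntegralSatake2020] X. Zhu, *A note on integral Satake isomorphisms*, arXiv:2005.13056, §1.3 Lemma 8.
* [TreumannVenkatesh2016] D. Treumann, A. Venkatesh, *Functoriality, Smith theory, and the Brauer homomorphism*, Ann. of Math.
  183 (2016), §7.2.
-/

noncomputable section

open scoped Valued WithZero Matrix MatrixGroups
open MonoidAlgebra Representation

namespace Literature.NumberTheory.Automorphic.HermitianLattice

open Literature.NumberTheory.Automorphic Literature.NumberTheory.Automorphic.CartanUnique
  Literature.NumberTheory.Automorphic.SymplecticCartan

variable {R : Type*} [CommRing R] {N : ℕ}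

/-! ## §1 Antidominant representatives of `W`-orbits -/

section Orbit

/-- **Every antisymmetric cocharacter `μ` has a `W = C_{S_N}(rev)`-conjugate in the antidominant cone** (`μ ∘ π` monotone):
the head-sum-lexicographically minimal element of the (finite) `W`-orbit of `μ` (g49-#6 `monotone_of_isMinOn_headSumVec`).
[cite: Herzig2010, §1.2] [cite: HenniartVigneras2013, §6.3, §7.13] -/
theorem exists_perm_rev_monotone_comp {μ : Fin N → ℤ} (hμ : ∀ i, μ (Fin.rev i) = -μ i) :
    ∃ π : Equiv.Perm (Fin N), (∀ i, π (Fin.rev i) = Fin.rev (π i)) ∧ Monotone (μ ∘ π) := by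
  classical
  set S : Finset (Fin N → ℤ) :=
    (Finset.univ.filter fun π : Equiv.Perm (Fin N) => ∀ i, π (Fin.rev i) = Fin.rev (π i)).image
      fun π : Equiv.Perm (Fin N) => μ ∘ ⇑π with hS
  have hmemS : ∀ {ν : Fin N → ℤ}, ν ∈ S ↔ ∃ π : Equiv.Perm (Fin N), (∀ i, π (Fin.rev i) = Fin.rev (π i)) ∧ μ ∘ ⇑π = ν := by
    intro ν
    simp only [hS, Finset.mem_image, Finset.mem_filter, Finset.mem_univ, true_and]
  have hstab : ∀ ν ∈ S, ∀ π : Equiv.Perm (Fin N), (∀ i, π (Fin.rev i) = Fin.rev (π i)) →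
      satakeTwistExp (ν ∘ π) ≤ satakeTwistExp ν → ν ∘ π ∈ S := by
    intro ν hν π hπ _
    obtain ⟨π₁, hπ₁, rfl⟩ := hmemS.1 hν
    exact hmemS.2 ⟨π₁ * π, perm_mul_rev hπ₁ hπ, by rw [Equiv.Perm.coe_mul, Function.comp_assoc]⟩
  have hanti : ∀ ν ∈ S, ∀ i, ν (Fin.rev i) = -ν i := by
    intro ν hν i
    obtain ⟨π₁, hπ₁, rfl⟩ := hmemS.1 hν
    rw [Function.comp_apply, Function.comp_apply, hπ₁, hμ]
  have hne : S.Nonempty := ⟨μ, hmemS.2 ⟨1, fun _ => rfl, by rw [Equiv.Perm.coe_one, Function.comp_id]⟩⟩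
  obtain ⟨a, haS, hmin⟩ := S.exists_min_image (fun ν => toLex (headSumVec ν)) hne
  obtain ⟨π₀, hπ₀, rfl⟩ := hmemS.1 haS
  exact ⟨π₀, hπ₀, monotone_of_isMinOn_headSumVec hstab hanti haS hmin⟩

omit [CommRing R] in
/-- **`⟨ν, ·⟩` detects the antidominant representative**: if `μ` is monotone and `⟨ν, μ∘π⟩ ≤ ⟨ν, μ⟩` then `μ ∘ π = μ` (Zhu's
rearrangement lemma `⟨ν, μ⟩ ≤ ⟨ν, μ∘π⟩` with its equality case, g43-#1). [cite: ZhuIntegralSatake2020, §1.3 Lemma 8]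
[cite: Herzig2010, §1.2] -/
theorem comp_perm_eq_self_of_monotone_of_satakeTwistExp_le {μ : Fin N → ℤ} (hμ : Monotone μ) (π : Equiv.Perm (Fin N))
    (hle : satakeTwistExp (μ ∘ π) ≤ satakeTwistExp μ) : μ ∘ π = μ :=
  (satakeTwistExp_comp_perm_eq_iff hμ π).1 (le_antisymm hle (satakeTwistExp_le_satakeTwistExp_comp_perm hμ π))

omit [CommRing R] in
/-- Undoing a coordinate permutation: `(μ ∘ π) ∘ π⁻¹ = μ` (private plumbing). [folklore] -/
private theorem comp_perm_comp_inv (μ : Fin N → ℤ) (π : Equiv.Perm (Fin N)) : (μ ∘ ⇑π) ∘ ⇑π⁻¹ = μ := by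
  rw [Function.comp_assoc, ← Equiv.Perm.coe_mul, mul_inv_cancel, Equiv.Perm.coe_one, Function.comp_id]

end Orbit

/-! ## §2 The twisted invariants at `b = 0`: functions supported on the antidominant cone -/

section Zero

/-- **`𝒯_R(b) = R[Λ^{--}]` when `b = 0` in `R`**: for `(b : R) = 0`, `f` lies in the twisted Weyl invariants `𝒯_R(b)` of g49-#6
iff every exponent of `f` is antidominant (monotone) and antisymmetric — the relation `f_μ = b^{⟨ν,μ⟩-⟨ν,m⟩} f_m` at the
antidominant representative `m` of the `W`-orbit of `μ` kills `f_μ` unless `⟨ν,μ⟩ = ⟨ν,m⟩`, i.e. `μ = m`.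
[cite: Herzig2010, Thm. 1.2, §1.2] [cite: HenniartVigneras2013, Thm. 1.5 (ii), §7.15 Remark 1] -/
theorem mem_twistedSatakeTarget_iff_of_cast_eq_zero {b : ℕ} (hb : (b : R) = 0) (f : AddMonoidAlgebra R (Fin N → ℤ)) :
    f ∈ twistedSatakeTarget R N b ↔ ∀ μ : Fin N → ℤ, f.coeff μ ≠ 0 → Monotone μ ∧ ∀ i, μ (Fin.rev i) = -μ i := by
  constructor
  · intro hf μ hμ
    have hanti : ∀ i, μ (Fin.rev i) = -μ i := by
      by_contra h
      exact hμ (hf.1 μ h)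
    refine ⟨?_, hanti⟩
    obtain ⟨π₀, hπ₀, hm⟩ := exists_perm_rev_monotone_comp hanti
    have hle : satakeTwistExp (μ ∘ π₀) ≤ satakeTwistExp ((μ ∘ ⇑π₀) ∘ ⇑π₀⁻¹) :=
      satakeTwistExp_le_satakeTwistExp_comp_perm hm π₀⁻¹
    have hrel := hf.2 π₀⁻¹ (perm_inv_rev hπ₀) (μ ∘ π₀) hle
    rw [comp_perm_comp_inv] at hrel hle
    rcases Nat.eq_zero_or_pos (satakeTwistExp μ - satakeTwistExp (μ ∘ π₀)).toNat with h0 | hpos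
    · have heq : μ ∘ π₀ = μ := by
        have h1 := comp_perm_eq_self_of_monotone_of_satakeTwistExp_le hm π₀⁻¹
        rw [comp_perm_comp_inv] at h1
        exact (h1 (by have := Int.toNat_eq_zero.1 h0; omega)).symm
      rw [← heq]
      exact hm
    · exact absurd (by rw [hrel, hb, zero_pow hpos.ne', zero_mul]) hμ
  · intro h
    refine ⟨fun μ hμ => ?_, fun π _ μ hle => ?_⟩
    · by_contra h0
      exact hμ (h μ h0).2
    · by_cases hμ0 : f.coeff μ = 0
      · -- both sides vanish: `f_{μ∘π} ≠ 0` would force `μ∘π` antidominant with `⟨ν,μ∘π⟩ ≥ ⟨ν,μ⟩`, hence `μ∘π∘π⁻¹ = μ∘π`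
        rw [hμ0, mul_zero]
        by_contra hne
        have h1 := comp_perm_eq_self_of_monotone_of_satakeTwistExp_le (h _ hne).1 π⁻¹
        rw [comp_perm_comp_inv] at h1
        exact hne (by rw [← h1 hle]; exact hμ0)
      · have hm := (h μ hμ0).1
        by_cases heq : satakeTwistExp (μ ∘ π) = satakeTwistExp μ
        · rw [comp_perm_eq_self_of_monotone_of_satakeTwistExp_le hm π heq.le, sub_self, Int.toNat_zero, pow_zero, one_mul]
        · have hlt : satakeTwistExp μ < satakeTwistExp (μ ∘ π) := lt_of_le_of_ne hle (Ne.symm heq)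
          have hpos : 0 < (satakeTwistExp (μ ∘ π) - satakeTwistExp μ).toNat := Int.lt_toNat.2 (by push_cast; omega)
          rw [hb, zero_pow hpos.ne', zero_mul]
          by_contra hne
          have h1 := comp_perm_eq_self_of_monotone_of_satakeTwistExp_le (h _ hne).1 π⁻¹
          rw [comp_perm_comp_inv] at h1
          exact heq (by rw [← h1 hle])

end Zero

variable {K : Type*} [Field K] [Valued K ℤᵐ⁰] {σ : K →+* K} {ϖ : K}

namespace UnramifiedLocalConjDatum

/-! ## §3 The mod-`p` Satake isomorphism for `U(σ, J₀)` -/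

/-- **`q_F = 0` in every ring of characteristic `p = char 𝓀`**: `q_F² = #𝓀 = p^n` with `n ≥ 1`, so `p ∣ q_F`.
[cite: Herzig2010, §1.2] [cite: HenniartVigneras2013, §7.15 Remark 1] -/
theorem natCast_sqrt_card_residueField_eq_zero_of_charP [Finite 𝓀[K]] (hd : UnramifiedLocalConjDatum σ ϖ) (hσ : ∃ x : K, σ x ≠ x)
    (p : ℕ) [CharP 𝓀[K] p] [CharP R p] : ((Nat.sqrt (Nat.card 𝓀[K]) : ℕ) : R) = 0 := by
  haveI := Fintype.ofFinite 𝓀[K]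
  obtain ⟨n, hp, hcard⟩ := FiniteField.card 𝓀[K] p
  rw [← Nat.card_eq_fintype_card, ← hd.sqrt_card_residueField_mul_self hσ] at hcard
  have hdvd : p ∣ Nat.sqrt (Nat.card 𝓀[K]) := by
    rcases hp.dvd_mul.1 (hcard ▸ dvd_pow_self p (PNat.ne_zero n)) with h | h <;> exact h
  obtain ⟨k, hk⟩ := hdvd
  rw [hk, Nat.cast_mul, CharP.cast_eq_zero R p, zero_mul]

variable [Finite 𝓀[K]]
  [IsHeckeTriple (⊤ : Submonoid (unitaryGroupOfForm σ ((StdForm.antidiagonal N).over K)))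
    (unitaryInt σ ((StdForm.antidiagonal N).over K)) (unitaryInt σ ((StdForm.antidiagonal N).over K))]

/-- **HERZIG'S THEOREM 1.2 FOR `U(σ, J₀)`, SUPPORT HALF: when `q_F = 0` in `R`, every exponent of `𝒮_1(T)` is antidominant**
(monotone and antisymmetric), for every `T ∈ ℋ(U_N, K₀; R)`. [cite: Herzig2010, Thm. 1.2, §1.2]
[cite: HenniartVigneras2013, Thm. 1.5 (ii)] -/
theorem monotone_of_coeff_satakeTransform_one_ne_zero_unitary (hd : UnramifiedLocalConjDatum σ ϖ) (hσ : ∃ x : K, σ x ≠ x)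
    (hq : ((Nat.sqrt (Nat.card 𝓀[K]) : ℕ) : R) = 0)
    (T : heckeAlgebra R (unitaryGroupOfForm σ ((StdForm.antidiagonal N).over K)) (unitaryInt σ ((StdForm.antidiagonal N).over K)))
    {μ : Fin N → ℤ} (hμ : ((hd.isIwasawaExponent (N := N)).satakeTransform (1 : Multiplicative (Fin N → ℤ) →* R) T).coeff μ ≠ 0) :
    Monotone μ ∧ ∀ i, μ (Fin.rev i) = -μ i :=
  (mem_twistedSatakeTarget_iff_of_cast_eq_zero hq _).1 (hd.satakeTransform_one_mem_twistedSatakeTarget hσ T) μ hμ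

/-- **HERZIG'S THEOREM 1.2 / HENNIART–VIGNÉRAS' THEOREM 1.5 FOR THE HYPERSPECIAL UNITARY GROUP (trivial weight), OVER EVERY
COMMUTATIVE RING `R` WITH `q_F = 0` IN `R`**: `f ∈ R[ℤ^N]` is the counting transform `𝒮_1(T)` of some `T ∈ ℋ(U_N, K₀; R)` iff
every exponent of `f` is antidominant and antisymmetric — `𝒮_1(ℋ_R) = R[Λ^{--}] = ℋ_T^-`. [cite: Herzig2010, Thm. 1.2]
[cite: HenniartVigneras2013, Thm. 1.5 (ii), §7.15 Thm. and Remark 1] -/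
theorem mem_range_satakeTransform_one_iff_of_cast_eq_zero_unitary (hd : UnramifiedLocalConjDatum σ ϖ) (hσ : ∃ x : K, σ x ≠ x)
    (hq : ((Nat.sqrt (Nat.card 𝓀[K]) : ℕ) : R) = 0) (f : AddMonoidAlgebra R (Fin N → ℤ)) :
    f ∈ ((hd.isIwasawaExponent (N := N)).satakeTransform (1 : Multiplicative (Fin N → ℤ) →* R)).range ↔
      ∀ μ : Fin N → ℤ, f.coeff μ ≠ 0 → Monotone μ ∧ ∀ i, μ (Fin.rev i) = -μ i := by
  rw [← mem_twistedSatakeTarget_iff_of_cast_eq_zero hq, ← hd.range_satakeTransform_one_eq_twistedSatakeTarget hσ,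
    AlgHom.mem_range, LinearMap.mem_range]
  rfl

/-- **Every antidominant monomial is a transform when `q_F = 0` in `R`**: `x^c ∈ 𝒮_1(ℋ_R)` for `c ∈ Λ^{--}` (Henniart–Vignéras:
`1_C ⊗ S_λ = 1_C ⊗ e_λ` lies in the image). [cite: HenniartVigneras2013, §7.15 Remark 1] [cite: Herzig2010, Thm. 1.2] -/
theorem single_mem_range_satakeTransform_one_unitary (hd : UnramifiedLocalConjDatum σ ϖ) (hσ : ∃ x : K, σ x ≠ x)
    (hq : ((Nat.sqrt (Nat.card 𝓀[K]) : ℕ) : R) = 0) {c : Fin N → ℤ} (hc : Monotone c ∧ ∀ i, c (Fin.rev i) = -c i) :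
    AddMonoidAlgebra.single c (1 : R) ∈
      ((hd.isIwasawaExponent (N := N)).satakeTransform (1 : Multiplicative (Fin N → ℤ) →* R)).range := by
  classical
  rw [hd.mem_range_satakeTransform_one_iff_of_cast_eq_zero_unitary hσ hq]
  intro μ hμ
  rw [AddMonoidAlgebra.coeff_single, Finsupp.single_apply] at hμ
  by_cases h : c = μ
  · rw [← h]; exact hc
  · exact absurd (if_neg h) hμ

/-- **The mod-`p` Satake isomorphism in characteristic `p = char 𝓀`**: for every commutative ring `R` of characteristic `p`,
`f ∈ 𝒮_1(ℋ(U_N, K₀; R))` iff every exponent of `f` is antidominant and antisymmetric. [cite: Herzig2010, Thm. 1.2]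
[cite: HenniartVigneras2013, Thm. 1.5 (ii)] -/
theorem mem_range_satakeTransform_one_iff_of_charP_unitary (hd : UnramifiedLocalConjDatum σ ϖ) (hσ : ∃ x : K, σ x ≠ x)
    (p : ℕ) [CharP 𝓀[K] p] [CharP R p] (f : AddMonoidAlgebra R (Fin N → ℤ)) :
    f ∈ ((hd.isIwasawaExponent (N := N)).satakeTransform (1 : Multiplicative (Fin N → ℤ) →* R)).range ↔
      ∀ μ : Fin N → ℤ, f.coeff μ ≠ 0 → Monotone μ ∧ ∀ i, μ (Fin.rev i) = -μ i :=
  hd.mem_range_satakeTransform_one_iff_of_cast_eq_zero_unitary hσ (hd.natCast_sqrt_card_residueField_eq_zero_of_charP hσ p) f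

omit [Finite 𝓀[K]]
  [IsHeckeTriple (⊤ : Submonoid (unitaryGroupOfForm σ ((StdForm.antidiagonal N).over K)))
    (unitaryInt σ ((StdForm.antidiagonal N).over K)) (unitaryInt σ ((StdForm.antidiagonal N).over K))] in
/-- **HERZIG'S COROLLARY 1.3 FOR `U(σ, J₀)`: `ℋ(U_N, K₀; R) ≃ₐ[R] 𝒮_1(ℋ_R)`** through the counting transform (injective over every
commutative `R`), the target being `R[Λ^{--}] = ℋ_T^-` when `q_F = 0` in `R`
(`mem_range_satakeTransform_one_iff_of_cast_eq_zero_unitary`). [cite: Herzig2010, Cor. 1.3] [cite: HenniartVigneras2013, §7.15] -/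
theorem exists_algEquiv_range_satakeTransform_one_unitary (hd : UnramifiedLocalConjDatum σ ϖ)
    [IsHeckeTriple (⊤ : Submonoid (unitaryGroupOfForm σ ((StdForm.antidiagonal N).over K)))
      (unitaryInt σ ((StdForm.antidiagonal N).over K)) (unitaryInt σ ((StdForm.antidiagonal N).over K))] :
    ∃ e : heckeAlgebra R (unitaryGroupOfForm σ ((StdForm.antidiagonal N).over K)) (unitaryInt σ ((StdForm.antidiagonal N).over K))
        ≃ₐ[R] ((hd.isIwasawaExponent (N := N)).satakeTransform (1 : Multiplicative (Fin N → ℤ) →* R)).range,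
      ∀ T, (e T : AddMonoidAlgebra R (Fin N → ℤ)) =
        (hd.isIwasawaExponent (N := N)).satakeTransform (1 : Multiplicative (Fin N → ℤ) →* R) T :=
  ⟨AlgEquiv.ofInjective _ (hd.satakeTransform_injective_of_commRing 1), fun _ => rfl⟩

omit [Finite 𝓀[K]] in
/-- **HERZIG'S COROLLARY 1.3 «In particular it is noetherian» FOR `U(σ, J₀)`, over every noetherian commutative ring `R`**
(from `ℋ(U_N, K₀; R) ≅ R[X_1, …, X_{⌊N/2⌋]`, g43-#5). [cite: Herzig2010, Cor. 1.3] [cite: HenniartVigneras2013, §7.16] -/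
theorem isNoetherianRing_heckeAlgebra_unitaryInt [IsNoetherianRing R] (hd : UnramifiedLocalConjDatum σ ϖ) :
    IsNoetherianRing (heckeAlgebra R (unitaryGroupOfForm σ ((StdForm.antidiagonal N).over K))
      (unitaryInt σ ((StdForm.antidiagonal N).over K))) := by
  obtain ⟨e, -⟩ := hd.exists_algEquiv_mvPolynomial_heckeAlgebra_unitaryInt (N := N) (R := R)
  exact isNoetherianRing_of_ringEquiv _ e.toRingEquiv

end UnramifiedLocalConjDatum

end Literature.NumberTheory.Automorphic.HermitianLattice

end
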